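import Literature.NumberTheory.EllipticCurves.BurungaleKobayashiNakamuraOta2026.RubinPadicLFunction
import HarnessLib

/-!
# Burungale–Kobayashi–Nakamura–Ota 2026 (arXiv:2608.06879, PREPRINT), §4 / §7 — the Rubin-type `p`-adic
# `L`-function datum in the WEIGHT-ONE CURRENCY: continuation of `L(ψ, s)` from its half-plane of
# absolute convergence; uniqueness of the elliptic-unit classes, Lemma 7.1 at `𝟙` and the transport of
# the datum threaded on `EllipticUnitClassData.HasReciprocityFrom` (PROOFS ONLY; 0 definitions, 0 facts)

Topic `NumberTheory/EllipticCurves`, sub-directory `BurungaleKobayashiNakamuraOta2026`; companion of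
`RubinPadicLFunction.lean` (rev 4) — typing layer `pub/bsd-littype/`, seat bsd-littype-10 gen 6, at the
request of cell `bsd-cm` (seat k7r-c4 g8, v4 DESIGN (i), pub/bsd-cm/STATUS 2026-08-27T03:59:57Z: "its
`hcont : HasEntireContinuation (heckeLFunction (φχ))` is the DEFECT-2 threshold — unsatisfiable for
weight-one `φ` — so `nonempty_of_compactAcSelmerVanishes`/`exists_forall_nonempty_of_PRE` are
vacuous-antecedent as typed: re-thread on `…From (3/2)`").

WHAT IS PROVED (module docstring (R8) of the companion). (1) **No junk in the `+` range**: the sign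
predicate `IsCentralRootNumberWt ψ k W` of [BKNO] Thm. 4.12 / Thm. 1.5 (an ENTIRE completed `L`-function
`Λ(s) = Γ(s) B^s L(ψ, s)` on `re s > k + 3/2` with `Λ(s) = W Λ(2k+2−s)`) itself supplies an entire
continuation of `L(ψ, s)` from `re s > k + 3/2`, namely `Λ(s) Γ(s)⁻¹ B^{−s}` (`1/Γ` is entire — Mathlib
`Complex.differentiable_one_div_Gamma` —, `Γ` has no zero on `re s > 0`, `B > 0`): so the tree's
`heckeCentralValue ψ k = entireContinuationFrom (k + 3/2) (heckeLFunction ψ) (k+1)` read by `thm412` is the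
genuine central value (`IsCentralRootNumberWt.hasEntireContinuationFrom`, weight `2`:
`hasEntireContinuationFrom_of_isCentralRootNumber`; `heckeCentralValue_eq_of_differentiable`). (2) **The
weight-one twins** of the sibling interface's `δ_sub_eq_zero` / `sub_mem_compactSelmerOver` / `z_eq` /
`hasBottomIndexExp_iff` (`AnticyclotomicEllipticUnitClass.lean`, all threaded on the uninhabited
`LFunction.HasEntireContinuation (heckeLFunction (φχ))`, threshold `re s > 1`) — here threaded on
`EllipticUnitClassData.HasReciprocityFrom` ([BKNO] Prop. 4.10 at `k = 0` with the continuation FROM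
`re s > 3/2`) and on continuations `hcont` at the ANTICYCLOTOMIC FINITE-ORDER characters only (for these
`φχ` has infinity type `(1, 0)` and `3/2` is the right abscissa; a binder over all `χ : HeckeCharacter K`
would again be uninhabited): `δ_sub_eq_zero_of_hasReciprocityFrom`,
`sub_mem_compactSelmerOver_of_hasReciprocityFrom`, `z_eq_of_hasReciprocityFrom` (UNIQUENESS of the classes
relative to `𝓔`, modulo `CompactAcSelmerVanishes` = Prop. 3.7 (3) + Lemma 5.2),
`hasBottomIndexExp_iff_of_hasReciprocityFrom`; Lemma 7.1 at `𝟙`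
(`bottom_mem_localKummerPi_of_hasReciprocityFrom`). (3) **The §5 transport re-threaded**:
`RubinPadicLFunctionData.hasReciprocityFrom` (a datum over `D` certifies `D.HasReciprocityFrom` — its field
`erlFrom`), `nonempty_of_hasReciprocityFrom` (for a fixed `(Ω, 𝓔)`, a datum over one `D` serves every `D'`
satisfying the weight-one reciprocity law), `exists_forall_nonempty_of_PRE_from` (the existence claim
`thm412_thm72_exists_padicLFunctionData_PRE` read for a fixed `(Ω, 𝓔)`). (4) **The `ξ₁` pin keyed on the
(P1) clause** (§3, appended same seat): `RubinPadicLFunctionData.ξ_eq_φac_iff` (`ξ₁ = φ(φ∘c)⁻¹ ↔ η∘c = η`,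
from the definition `ξ_eq`), `interpolatedCharacter_eq_of_ξ_eq`, `thm412_of_ξ_eq`, `thm412_one_of_ξ_eq`
(Thm. 4.12 with the character `φ^{2k+1}χ`, resp. `φ^{2k+1}` at `χ = 𝟙`, for consumers carrying
`hξ : R.ξ = φ * (galConj c φ)⁻¹` — the K7r package `RamifiedCMRubinPackageAtZp` (P1)). HONEST STATUS: every statement
here is PROVED from the interface; [BKNO] is an unrefereed preprint and nothing of it is asserted; nothing
here is about BSD.

## References

* [BurungaleKobayashiNakamuraOta2026] A. Burungale, S. Kobayashi, K. Nakamura, K. Ota, arXiv:2608.06879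
  (2026): Prop. 3.7 (3), §3.1.2, Prop. 4.10, §4.1.2, Thm. 4.12, Lemma 5.2, Lemma 7.1 (pp. 16, 19–20, 25,
  31–33, 40). Held text `paper:arxiv-2608.06879`.
* [Jia2026ActaArith] Jia, Acta Arith. (2026) §2 (3)–(5) (the completed `L`-function; the tree's
  `IsCentralRootNumber`).
* [NeukirchANT1999] J. Neukirch, *Algebraic Number Theory*, Ch. VII §5 (continuation from a half-plane).
* [BlochKato1990] S. Bloch, K. Kato (1990), Example 3.11 (`H¹_f` = Kummer).
-/

noncomputable section

open scoped Classical

open NumberField IsDedekindDomain Field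
  Literature.NumberTheory.EllipticCurves Literature.NumberTheory.GaloisRepresentations
  Literature.NumberTheory.DiophantineGeometry

namespace Literature.NumberTheory.EllipticCurves.BurungaleKobayashiNakamuraOta2026

open _root_.WeierstrassCurve

/-! ## §1. Continuation from the sign predicate (no junk in the `+` range) -/

section Weight

variable {K : Type} [Field K] [NumberField K]

/-- Any entire function agreeing with `L(ψ, s)` on `re s > k + 3/2` computes `heckeCentralValue ψ k` (the
continuation from a half-plane is unique, `LFunction.entireContinuationFrom_eq_of_mem`). PROVED.
[cite: BurungaleKobayashiNakamuraOta2026, Thm. 4.12 (arXiv:2608.06879 p. 32) (the value `L(ψ, k+1)`; shape only)] -/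
theorem heckeCentralValue_eq_of_differentiable (ψ : HeckeCharacter K) (k : ℕ) {g : ℂ → ℂ}
    (hg : Differentiable ℂ g) (hgL : ∀ s : ℂ, (k : ℝ) + 3 / 2 < s.re → g s = heckeLFunction ψ s) :
    heckeCentralValue ψ k = g ((k : ℂ) + 1) := by
  rw [heckeCentralValue, LFunction.entireContinuationFrom_eq_of_mem ⟨hg, hgL⟩]

/-- **No junk in the `+` range**: the sign predicate `IsCentralRootNumberWt ψ k W` itself supplies an
ENTIRE continuation of `L(ψ, s)` from `re s > k + 3/2`, namely `Λ(s) · Γ(s)⁻¹ · B^{−s}` (`1/Γ` is entire,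
`Γ` has no zero on `re s > 0`, `B > 0`) — so under the hypothesis of Thm. 4.12 the tree's
`heckeCentralValue ψ k` is the genuine central value `L(ψ, k+1)`, never the junk Euler product (R8). PROVED.
[cite: BurungaleKobayashiNakamuraOta2026, §4.1.2 and Thm. 4.12 (arXiv:2608.06879 pp. 25, 32) (shape only)]
[cite: Jia2026ActaArith, §2 (3)–(5)] -/
theorem IsCentralRootNumberWt.hasEntireContinuationFrom {ψ : HeckeCharacter K} {k : ℕ} {W : ℂ}
    (h : IsCentralRootNumberWt ψ k W) :
    LFunction.HasEntireContinuationFrom ((k : ℝ) + 3 / 2) (heckeLFunction ψ) := by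
  obtain ⟨B, hB, Λ, hΛ, hΛL, -⟩ := h
  have hB0 : (B : ℂ) ≠ 0 := by exact_mod_cast hB.ne'
  refine ⟨fun s ↦ Λ s * (Complex.Gamma s)⁻¹ * (B : ℂ) ^ (-s), ?_, fun s hs ↦ ?_⟩
  · exact (hΛ.mul Complex.differentiable_one_div_Gamma).mul
      fun s ↦ (differentiableAt_id.neg).const_cpow (Or.inl hB0)
  · have hre : 0 < s.re := by
      have : (0 : ℝ) ≤ (k : ℝ) := Nat.cast_nonneg k
      linarith
    have hΓ : Complex.Gamma s ≠ 0 := Complex.Gamma_ne_zero_of_re_pos hre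
    have hBs : (B : ℂ) ^ s ≠ 0 := by
      rw [Complex.cpow_def_of_ne_zero hB0]; exact Complex.exp_ne_zero _
    show Λ s * _ * _ = _
    rw [hΛL s hs, Complex.cpow_neg]
    field_simp

/-- In weight `2`: `IsCentralRootNumber ψ W` supplies an entire continuation of `L(ψ, s)` from `re s > 3/2`
(the antecedent of `thm72_one` / of the sibling's readings is in the weight-one currency). PROVED.
[cite: Jia2026ActaArith, §2 (3)–(5)] -/
theorem hasEntireContinuationFrom_of_isCentralRootNumber {ψ : HeckeCharacter K} {W : ℂ}
    (h : IsCentralRootNumber ψ W) :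
    LFunction.HasEntireContinuationFrom (3 / 2) (heckeLFunction ψ) := by
  simpa using ((isCentralRootNumberWt_zero_iff ψ W).2 h).hasEntireContinuationFrom

end Weight

/-! ## §2. The weight-one currency: uniqueness of the classes, Lemma 7.1 at `𝟙`, and the
transport of §5, threaded on `HasReciprocityFrom` — continuation of `L(φχ, s)` from `re s > 3/2` -/

section WeightOne

variable {W : WeierstrassCurve ℚ} {p : ℕ} [Fact p.Prime] {K : Type} [Field K] [NumberField K]
  {c : K ≃ₐ[ℚ] K} {𝔭 : HeightOneSpectrum (𝓞 K)} {κ : ZpExtension K p} {γ : absoluteGaloisGroup K}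
  {ι : PadicAlgCl p ≃+* ℂ} {φ : HeckeCharacter K} {Ω : ℂ} {𝓔 : AcDualExpSystem W p K 𝔭 κ ι}
  [W.IsElliptic]

namespace EllipticUnitClassData

/-- `HasReciprocityFrom` with the `L`-value written as `heckeCentralValue (φχ) 0 / Ω` (the currency of §1 and
of `interpolationValue_zero_empty`). PROVED (`heckeCentralValue_zero`).
[cite: BurungaleKobayashiNakamuraOta2026, Prop. 4.10 at `k = 0` (arXiv:2608.06879 p. 31) (claim; preprint; shape only)] -/
theorem hasReciprocityFrom_iff (D : EllipticUnitClassData W p K 𝔭 κ γ ι φ Ω 𝓔) :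
    D.HasReciprocityFrom ↔
      ∀ (n : ℕ) (χ : HeckeCharacter K) (r : FramedGaloisRep K (PadicAlgCl p) 1), IsAcCharacter ι κ n χ r →
        LFunction.HasEntireContinuationFrom (3 / 2) (heckeLFunction (φ * χ)) →
          𝓔.δ n r (D.z n) = ((ι.symm (heckeCentralValue (φ * χ) 0 / Ω) : PadicAlgCl p) : ℂ_[p]) := by
  simp only [HasReciprocityFrom, heckeCentralValue_zero]

/-- Two data over the SAME `(Ω, 𝓔)`, both satisfying the weight-one reciprocity law, have the same
`exp*`-values at every finite-order `χ` whose `L(φχ, s)` has an entire continuation from `re s > 3/2`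
(both equal `ι⁻¹(L(φχ,1)/Ω)`): `δ n r (z_n − z'_n) = 0`. The weight-one twin of the sibling's
`δ_sub_eq_zero`. PROVED. [cite: BurungaleKobayashiNakamuraOta2026, Prop. 4.10 (arXiv:2608.06879 p. 31) (claim; preprint; shape only)] -/
theorem δ_sub_eq_zero_of_hasReciprocityFrom {D D' : EllipticUnitClassData W p K 𝔭 κ γ ι φ Ω 𝓔}
    (hD : D.HasReciprocityFrom) (hD' : D'.HasReciprocityFrom)
    {n : ℕ} {χ : HeckeCharacter K} {r : FramedGaloisRep K (PadicAlgCl p) 1}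
    (h : IsAcCharacter ι κ n χ r)
    (hL : LFunction.HasEntireContinuationFrom (3 / 2) (heckeLFunction (φ * χ))) :
    𝓔.δ n r (D.z n - D'.z n) = 0 := by
  rw [map_sub, hD n χ r h hL, hD' n χ r h hL, sub_self]

/-- Hence `z_n − z'_n` is Kummer above `𝔭` and lies in the FULL compact Selmer group `S_p(E/K^{ac}_n)` — given
the continuations from `re s > 3/2` at the finite-order characters of level `≤ n` (binder `hcont`, over the
anticyclotomic characters ONLY: for these `φχ` has infinity type `(1, 0)`). The weight-one twin of the
sibling's `sub_mem_compactSelmerOver`. PROVED.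
[cite: BurungaleKobayashiNakamuraOta2026, §3.1.2 and Prop. 4.10 (arXiv:2608.06879 pp. 16, 31) (claim; preprint; shape only)]
[cite: BlochKato1990, Example 3.11] -/
theorem sub_mem_compactSelmerOver_of_hasReciprocityFrom {D D' : EllipticUnitClassData W p K 𝔭 κ γ ι φ Ω 𝓔}
    (hD : D.HasReciprocityFrom) (hD' : D'.HasReciprocityFrom)
    (hcont : ∀ (n : ℕ) (χ : HeckeCharacter K) (r : FramedGaloisRep K (PadicAlgCl p) 1),
      IsAcCharacter ι κ n χ r → LFunction.HasEntireContinuationFrom (3 / 2) (heckeLFunction (φ * χ)))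
    (n : ℕ) : D.z n - D'.z n ∈ (W.baseChange K).compactSelmerOver (κ.layerSubgroup n) p := by
  have hrel : D.z n - D'.z n ∈ (W.baseChange K).relaxedCompactSelmerOver (κ.layerSubgroup n) p {𝔭} :=
    sub_mem (D.z_mem n) (D'.z_mem n)
  have hcomp : D.z n - D'.z n ∈ (W.baseChange K).compatiblePi (κ.layerSubgroup n) p :=
    (mem_relaxedCompactSelmerOver_iff.1 hrel).2
  have hkum : D.z n - D'.z n ∈ (W.baseChange K).localKummerPi (κ.layerSubgroup n) p {𝔭} :=
    (𝓔.δ_eq_zero_iff n _ hcomp).1 fun χ r h ↦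
      δ_sub_eq_zero_of_hasReciprocityFrom hD hD' h (hcont n χ r h)
  rw [← (W.baseChange K).relaxedCompactSelmerOver_inf_localKummerPi (κ.layerSubgroup n) p {𝔭}]
  exact ⟨hrel, hkum⟩

/-- **UNIQUENESS of the elliptic-unit class relative to `𝓔`, in the weight-one currency** (supersedes the
sibling's `z_eq`, whose `hcont` is uninhabited, (R8)): two data over the same `(ι, φ, Ω, 𝓔)` satisfying
`HasReciprocityFrom` have `z_n = z'_n`, GIVEN `𝒮^{ac}_f = 0` (`CompactAcSelmerVanishes`, = [BKNO] Prop. 3.7 (3)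
+ Lemma 5.2) and entire continuations from `re s > 3/2` of the `L(φχ, s)` at the anticyclotomic finite-order
`χ`. Proof: `z − z'` is a norm-compatible compact Selmer family, hence zero. PROVED.
[cite: BurungaleKobayashiNakamuraOta2026, Prop. 3.7 (3), Prop. 4.10, Lemma 5.2 (arXiv:2608.06879 pp. 19–20, 31, 33) (claim; preprint; shape only)] -/
theorem z_eq_of_hasReciprocityFrom (hS : CompactAcSelmerVanishes W p K κ γ)
    (hcont : ∀ (n : ℕ) (χ : HeckeCharacter K) (r : FramedGaloisRep K (PadicAlgCl p) 1),
      IsAcCharacter ι κ n χ r → LFunction.HasEntireContinuationFrom (3 / 2) (heckeLFunction (φ * χ)))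
    {D D' : EllipticUnitClassData W p K 𝔭 κ γ ι φ Ω 𝓔}
    (hD : D.HasReciprocityFrom) (hD' : D'.HasReciprocityFrom) (n : ℕ) : D.z n = D'.z n := by
  have h := hS (fun n ↦ D.z n - D'.z n)
    (fun n ↦ sub_mem_compactSelmerOver_of_hasReciprocityFrom hD hD' hcont n)
    (fun n ↦ by
      rw [map_sub, D.z_norm n, D'.z_norm n, ← Finset.sum_sub_distrib]
      exact Finset.sum_congr rfl fun i _ ↦ (map_sub _ _ _).symm) n
  exact sub_eq_zero.1 h

/-- **The bottom index exponent is independent of the datum** (relative to `𝓔`), weight-one currency: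
corollary of `z_eq_of_hasReciprocityFrom`. PROVED.
[cite: BurungaleKobayashiNakamuraOta2026, Prop. 3.7 (3) (arXiv:2608.06879 p. 19) (claim; preprint; shape only)] -/
theorem hasBottomIndexExp_iff_of_hasReciprocityFrom (hS : CompactAcSelmerVanishes W p K κ γ)
    (hcont : ∀ (n : ℕ) (χ : HeckeCharacter K) (r : FramedGaloisRep K (PadicAlgCl p) 1),
      IsAcCharacter ι κ n χ r → LFunction.HasEntireContinuationFrom (3 / 2) (heckeLFunction (φ * χ)))
    {D D' : EllipticUnitClassData W p K 𝔭 κ γ ι φ Ω 𝓔}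
    (hD : D.HasReciprocityFrom) (hD' : D'.HasReciprocityFrom) (c : ℕ) :
    D.HasBottomIndexExp c ↔ D'.HasBottomIndexExp c := by
  unfold HasBottomIndexExp
  rw [z_eq_of_hasReciprocityFrom hS hcont hD hD' 0]

/-- **Lemma 7.1 at `χ = 𝟙`, weight-one currency** (supersedes `bottom_mem_localKummerPi_of_forall`): if `D`
satisfies the reciprocity law from `re s > 3/2` and at every level-`0` character `L(φχ, s)` has an entire
continuation from `re s > 3/2` VANISHING at `s = 1` (rank one: `L(φ, 1) = 0`; at level `0` only the
trivial character occurs), then `z(𝟙)` is Kummer above `𝔭`, hence lies in the FULL compact Selmer group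
`S_p(E/K)` (exact kernel of `𝓔`). PROVED. [cite: BurungaleKobayashiNakamuraOta2026, Lemma 7.1 (arXiv:2608.06879 p. 40) (claim; preprint)]
[cite: BlochKato1990, Example 3.11] -/
theorem bottom_mem_localKummerPi_of_hasReciprocityFrom (D : EllipticUnitClassData W p K 𝔭 κ γ ι φ Ω 𝓔)
    (hD : D.HasReciprocityFrom)
    (h0 : ∀ (χ : HeckeCharacter K) (rχ : FramedGaloisRep K (PadicAlgCl p) 1), IsAcCharacter ι κ 0 χ rχ →
      LFunction.HasEntireContinuationFrom (3 / 2) (heckeLFunction (φ * χ)) ∧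
        LFunction.entireContinuationFrom (3 / 2) (heckeLFunction (φ * χ)) 1 = 0) :
    D.z 0 ∈ (W.baseChange K).localKummerPi (κ.layerSubgroup 0) p {𝔭} ∧
      D.z 0 ∈ (W.baseChange K).compactSelmerOver (κ.layerSubgroup 0) p := by
  have hcomp : D.z 0 ∈ (W.baseChange K).compatiblePi (κ.layerSubgroup 0) p :=
    (mem_relaxedCompactSelmerOver_iff.1 (D.z_mem 0)).2
  have hkum : D.z 0 ∈ (W.baseChange K).localKummerPi (κ.layerSubgroup 0) p {𝔭} := by
    refine (𝓔.δ_eq_zero_iff 0 _ hcomp).1 fun χ rχ hχ ↦ ?_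
    obtain ⟨hL, hL0⟩ := h0 χ rχ hχ
    rw [hD 0 χ rχ hχ hL, hL0, zero_div, map_zero]
    rfl
  refine ⟨hkum, ?_⟩
  rw [← (W.baseChange K).relaxedCompactSelmerOver_inf_localKummerPi (κ.layerSubgroup 0) p {𝔭}]
  exact ⟨D.z_mem 0, hkum⟩

end EllipticUnitClassData

namespace RubinPadicLFunctionData

variable {D D' : EllipticUnitClassData W p K 𝔭 κ γ ι φ Ω 𝓔}

/-- A Rubin `L`-function datum over `D` certifies the weight-one reciprocity law of `D` (the field
`erlFrom`). [cite: BurungaleKobayashiNakamuraOta2026, Prop. 4.10 (arXiv:2608.06879 p. 31) (claim; preprint; shape only)] -/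
theorem hasReciprocityFrom (R : RubinPadicLFunctionData W p K c 𝔭 κ γ ι φ Ω 𝓔 D) :
    D.HasReciprocityFrom :=
  R.erlFrom

/-- **For a fixed `(Ω, 𝓔)`, one datum serves every datum satisfying the weight-one reciprocity law**
(supersedes `nonempty_of_compactAcSelmerVanishes`, (R8)): granted `𝒮^{ac}_f = 0` and continuations from
`re s > 3/2` at the anticyclotomic finite-order `χ`, a `RubinPadicLFunctionData` over `D` yields one over
every `D'` over the same `(Ω, 𝓔)` with `D'.HasReciprocityFrom` (`z_eq_of_hasReciprocityFrom` + `transport`).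
PROVED. [cite: BurungaleKobayashiNakamuraOta2026, Prop. 3.7 (3), Lemma 5.2, Def. 4.7 (arXiv:2608.06879 pp. 19, 27, 33) (claim; preprint)] -/
theorem nonempty_of_hasReciprocityFrom (hS : CompactAcSelmerVanishes W p K κ γ)
    (hcont : ∀ (n : ℕ) (χ : HeckeCharacter K) (r : FramedGaloisRep K (PadicAlgCl p) 1),
      IsAcCharacter ι κ n χ r → LFunction.HasEntireContinuationFrom (3 / 2) (heckeLFunction (φ * χ)))
    (R : RubinPadicLFunctionData W p K c 𝔭 κ γ ι φ Ω 𝓔 D)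
    (D' : EllipticUnitClassData W p K 𝔭 κ γ ι φ Ω 𝓔) (hD' : D'.HasReciprocityFrom) :
    Nonempty (RubinPadicLFunctionData W p K c 𝔭 κ γ ι φ Ω 𝓔 D') :=
  ⟨R.transport fun n ↦ EllipticUnitClassData.z_eq_of_hasReciprocityFrom hS hcont hD' R.erlFrom n⟩

end RubinPadicLFunctionData

/-- **The existence claim read for a fixed `(Ω, 𝓔)`, weight-one currency** (supersedes
`exists_forall_nonempty_of_PRE`, (R8)): under its antecedents and granted
`prop37_lemma52_compactAcSelmerVanishes_CLAIMED` and the continuations from `re s > 3/2` at the anticyclotomic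
finite-order characters, there are `Ω ≠ 0` and `𝓔` over which SOME elliptic-unit class datum satisfies
the weight-one reciprocity law and EVERY datum satisfying it carries an `L`-function datum. PROVED from
the two claims. [cite: BurungaleKobayashiNakamuraOta2026, Def. 4.7, Prop. 4.10, Thm. 4.12, Thm. 7.2 (arXiv:2608.06879 pp. 27, 31–32, 41) (claim; preprint)] -/
theorem exists_forall_nonempty_of_PRE_from (h : thm412_thm72_exists_padicLFunctionData_PRE)
    (hS37 : prop37_lemma52_compactAcSelmerVanishes_CLAIMED)
    (W : WeierstrassCurve ℚ) [W.IsElliptic] [W.IsGloballyMinimal] (p : ℕ) [Fact p.Prime]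
    (K : Type) [Field K] [NumberField K] (c : K ≃ₐ[ℚ] K) (hc : c ≠ 1) (𝔭 : HeightOneSpectrum (𝓞 K))
    (κ : ZpExtension K p) (γ : absoluteGaloisGroup K) (ι : PadicAlgCl p ≃+* ℂ) (φ : HeckeCharacter K)
    (hCM : W.HasCM) (hj : W.j ∈ maximalCMJInvariants) (hram : Rank1Residual.CMRamified W p) (hp : 5 ≤ p)
    (hK : IsImaginaryQuadratic K) (hd : NumberField.discr K = Rank1Residual.cmFieldDiscrOfJ W.j)
    (h𝔭 : ((p : ℕ) : 𝓞 K) ∈ 𝔭.asIdeal) (hκ : κ.IsAnticyclotomic) (hγ : κ.IsTopGenerator γ)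
    (hφ : φ.HasInfinityType (fun _ ↦ 1) (fun _ ↦ 0))
    (hL : ∀ s : ℂ, 3 / 2 < s.re → heckeLFunction φ s = W.LSeries s)
    (hcont : ∀ (n : ℕ) (χ : HeckeCharacter K) (r : FramedGaloisRep K (PadicAlgCl p) 1),
      IsAcCharacter ι κ n χ r → LFunction.HasEntireContinuationFrom (3 / 2) (heckeLFunction (φ * χ))) :
    ∃ (Ω : ℂ) (𝓔 : AcDualExpSystem W p K 𝔭 κ ι), Ω ≠ 0 ∧
      (∃ D : EllipticUnitClassData W p K 𝔭 κ γ ι φ Ω 𝓔, D.HasReciprocityFrom) ∧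
      ∀ D' : EllipticUnitClassData W p K 𝔭 κ γ ι φ Ω 𝓔, D'.HasReciprocityFrom →
        Nonempty (RubinPadicLFunctionData W p K c 𝔭 κ γ ι φ Ω 𝓔 D') := by
  obtain ⟨Ω, 𝓔, D, hΩ, ⟨R⟩⟩ := h W p K c 𝔭 κ γ ι φ hCM hj hram hp hK hd h𝔭 hκ hγ hc hφ hL
  exact ⟨Ω, 𝓔, hΩ, ⟨D, R.erlFrom⟩, fun D' hD' ↦
    R.nonempty_of_hasReciprocityFrom (hS37 W p K κ γ hCM hram hp hK hd hκ hγ) hcont D' hD'⟩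

end WeightOne

/-! ## §3 (appended, same seat). The pin keyed on the (P1) clause `R.ξ = φ (φ∘c)⁻¹` itself -/

section PinByXi

variable {W : WeierstrassCurve ℚ} {p : ℕ} [Fact p.Prime] {K : Type} [Field K] [NumberField K]
  {c : K ≃ₐ[ℚ] K} {𝔭 : HeightOneSpectrum (𝓞 K)} {κ : ZpExtension K p} {γ : absoluteGaloisGroup K}
  {ι : PadicAlgCl p ≃+* ℂ} {φ : HeckeCharacter K} {Ω : ℂ} {𝓔 : AcDualExpSystem W p K 𝔭 κ ι}
  [W.IsElliptic] {D : EllipticUnitClassData W p K 𝔭 κ γ ι φ Ω 𝓔}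

namespace RubinPadicLFunctionData

/-- `ξ₁ = φ_ac` IFF `η_ac = 𝟙` iff `η∘c = η`: the (P1) clause of the K7r package
(`R.ξ = φ * (galConj c φ)⁻¹`, `Summit.…X12.O11.RamifiedCMRubinPackageAtZp`) is EQUIVALENT to the
`c`-invariance of [BKNO]'s `η` (given the definition `ξ_eq`). PROVED (group algebra).
[cite: BurungaleKobayashiNakamuraOta2026, §4.2 (arXiv:2608.06879 p. 26) (`φ_ac`, `η_ac`, `ξ = φ_ac^k η_ac^{−k} χ`)] -/
theorem ξ_eq_φac_iff (R : RubinPadicLFunctionData W p K c 𝔭 κ γ ι φ Ω 𝓔 D) :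
    R.ξ = φ * (HeckeCharacter.galConj c φ)⁻¹ ↔ HeckeCharacter.galConj c R.η = R.η := by
  refine ⟨fun h ↦ ?_, R.ξ_eq_of_galConj_η_eq⟩
  have h' := R.φac_mul_ξ_inv_eq
  rw [h, mul_inv_cancel] at h'
  exact (eq_of_mul_inv_eq_one h'.symm).symm

/-- Under the (P1) clause `ξ₁ = φ (φ∘c)⁻¹` the interpolated character `φ^{k+1} (φ∘c)^k ξ₁^k χ` of
Thm. 4.12 IS `φ^{2k+1} χ` (keyed on the clause itself, for consumers that carry `hξ` rather than
`η∘c = η`). PROVED. [cite: BurungaleKobayashiNakamuraOta2026, Thm. 4.12 (arXiv:2608.06879 p. 32) (the character `φ^{2k+1}η_ac^{−k}χ` at `η_ac = 𝟙`)] -/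
theorem interpolatedCharacter_eq_of_ξ_eq (R : RubinPadicLFunctionData W p K c 𝔭 κ γ ι φ Ω 𝓔 D)
    (hξ : R.ξ = φ * (HeckeCharacter.galConj c φ)⁻¹) (k : ℕ) (χ : HeckeCharacter K) :
    φ ^ (k + 1) * HeckeCharacter.galConj c φ ^ k * R.ξ ^ k * χ = φ ^ (2 * k + 1) * χ :=
  R.interpolatedCharacter_eq_of_galConj_η_eq (R.ξ_eq_φac_iff.1 hξ) k χ

/-- **Thm. 4.12 with the character `φ^{2k+1} χ`, keyed on the (P1) clause**: if `ξ₁ = φ (φ∘c)⁻¹` and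
`ε(φ^{2k+1}χ) = +1` in weight `2k+2`, then `δ(ξ₁^kχ) ≠ 0` and
`ξ(ℒ) · δ(ξ₁^kχ) = ι⁻¹((−2π/√|d_K|)^k L_{pf}(φ^{2k+1}χ, k+1)/Ω^{2k+1})` at `T = r̂₁(γ)^k r̂_χ(γ) − 1`; and the
sign hypothesis itself supplies the continuation of `L(φ^{2k+1}χ, s)` from `re s > k + 3/2`
(`IsCentralRootNumberWt.hasEntireContinuationFrom`), so the value is genuine. PROVED.
[cite: BurungaleKobayashiNakamuraOta2026, Thm. 4.12 and Thm. 1.5 (arXiv:2608.06879 pp. 6, 32) (claim; preprint)] -/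
theorem thm412_of_ξ_eq (R : RubinPadicLFunctionData W p K c 𝔭 κ γ ι φ Ω 𝓔 D)
    (hξ : R.ξ = φ * (HeckeCharacter.galConj c φ)⁻¹) {k n : ℕ}
    {χ : HeckeCharacter K} {rχ : FramedGaloisRep K (PadicAlgCl p) 1} (hχ : IsAcCharacter ι κ n χ rχ)
    (hsgn : IsCentralRootNumberWt (φ ^ (2 * k + 1) * χ) k 1) :
    R.δ k rχ ≠ 0 ∧ ∃ v : ℂ_[p],
      IntSeries.HasValueAt R.L (avatarValueAt R.r γ ^ k * avatarValueAt rχ γ - 1) v ∧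
      v * R.δ k rχ =
        ((ι.symm (interpolationValue R.badPrimes (φ ^ (2 * k + 1) * χ) k Ω) : PadicAlgCl p) : ℂ_[p]) :=
  R.thm412_of_galConj_η_eq (R.ξ_eq_φac_iff.1 hξ) hχ hsgn

/-- At `χ = 𝟙` (`r_𝟙 = 1`, the S_relval instance `k = p^m`): under the (P1) clause and `ε(φ^{2k+1}) = +1`,
`δ k 1 ≠ 0` and the value `v` of `ℒ` at `T = r̂₁(γ)^k − 1` satisfies
`v · δ k 1 = ι⁻¹(interpolationValue badPrimes (φ^{2k+1}) k Ω)`. PROVED (`mul_one`, `avatarValueAt_one_left`).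
[cite: BurungaleKobayashiNakamuraOta2026, Thm. 1.5 (arXiv:2608.06879 p. 6) (claim; preprint)] -/
theorem thm412_one_of_ξ_eq (R : RubinPadicLFunctionData W p K c 𝔭 κ γ ι φ Ω 𝓔 D)
    (hξ : R.ξ = φ * (HeckeCharacter.galConj c φ)⁻¹) {k n : ℕ}
    (hone : IsAcCharacter ι κ n (1 : HeckeCharacter K) 1)
    (hsgn : IsCentralRootNumberWt (φ ^ (2 * k + 1)) k 1) :
    R.δ k 1 ≠ 0 ∧ ∃ v : ℂ_[p],
      IntSeries.HasValueAt R.L (avatarValueAt R.r γ ^ k - 1) v ∧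
      v * R.δ k 1 =
        ((ι.symm (interpolationValue R.badPrimes (φ ^ (2 * k + 1)) k Ω) : PadicAlgCl p) : ℂ_[p]) := by
  have h := R.thm412_of_ξ_eq hξ (k := k) hone (by rwa [mul_one])
  simpa only [mul_one, avatarValueAt_one_left] using h

end RubinPadicLFunctionData

end PinByXi

end Literature.NumberTheory.EllipticCurves.BurungaleKobayashiNakamuraOta2026

end
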